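import Literature.AnabelianGeometry.EtaleTheta.ConstantMultipleIndeterminacy
import Literature.AnabelianGeometry.EtaleTheta.FrobenioidRootTransport

/-!
# [EtTh] §5 at ALL levels `N`: the tower of roots `(A_N, B_N, s^⊓_N, s^⊔_N)_N` with the Remark 4.3.2 / Corollary 5.12 transitions (pp. 318–319, 339 / PDF pp. 92–93, 113)

Mochizuki, *The étale theta function …*, Publ. RIMS **45** (2009)
[cite: MochizukiEtTh2009, Rmk 4.3.2 p.318–319 (PDF pp.92–93)].  Seat abc-iut-L2-t4 (§5 owner); requested by the consumer
abc-iut-L2-d4 (holder of EtTh:Thm5.7; INBOX 2026-08-25T23:50:34Z / 2026-08-26T00:04:32Z O1).  ADDITIVE: no landed file is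
edited; every landed §5 statement applies LEVEL-WISE through `ThetaFrobenioidTower.atLevel`.

WHY.  The §5 data `ThetaFrobenioid` (FrobenioidTheta.lean) fix ONE integer "`N ≥ 1`" (p.323 (PDF p.97)).  Print,
however, lets `N` vary: Remark 4.3.2 (pp.318–319 (PDF pp.92–93)) — "if `N` divides `N' ∈ ℕ_{≥1}`, then … given an
`N'`-th root of the fraction-pair `(s', s'')` …, there exists a 'morphism' from a suitable `N'`-th root … to the
given `N`-th root …, i.e., a pair of commutative diagrams [`s'_{N'} ; β_{N,N'} = α_{N,N'} ; s'_N`, same with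
`s''`] — where `α_{N,N'}` (respectively, `β_{N,N'}`) is an isometry of Frobenius degree `N'/N` …; `α_{N,N'}` is
of base-Frobenius type … by allowing `N` to vary, we obtain a compatible system of roots of the fraction-pair
`(s', s'')` hence a compatible system of Kummer classes, which, by Proposition 3.2, (iii), is sufficient to
distinguish `f` from other elements of `O^×(A^birat)`"; Corollary 5.12 (p.339 (PDF p.113)) uses one such transition
`(α_{N,N'}, β_{N,N'})` (abc-iut-L2-t4's `ConstantMultiple.RootMorphismData`, landed p407037); and the printed proof
of Theorem 5.7 (p.330 (PDF p.104)) obtains its "`2l`-th root of unity" rigidity from the étale theta CLASS (all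
levels: Thm. 5.6 + Prop. 5.2 (iii) + Cor. 2.8 (i)) — abc-iut-L2-d4's discharge `Discharge/Sec5Thm57.lean`
(p411949) isolates exactly this as the one residual binder `hrig` and shows (kernel witness
`sgpCupSpec_comp_of_central`) that it is NOT derivable from level-`N` data alone.  This file supplies the
level-free carrier on which that residual becomes a statement about compatible systems:
* `ThetaFrobenioidTower C D` — the level-free part of the §5 data (the tempered-Frobenioid stub, `l`, `A_⊚`,
  `Π^tp_X̲ ⊇ Π^tp_Y̲ ⊇ Π^tp_Ÿ̲`, `K`, `Θ̈`) + for EVERY `N ≥ 1` the level-`N` data `(A_N, B_N, s^⊓_N, s^⊔_N, ρ_N,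
  s^trv_N, s^⊓-gp_N, s^⊔-gp_N, K^× ↪ O^×(B_N^birat))` + for every `N ∣ N'` a Remark-4.3.2 transition
  `(α_{N,N'}, β_{N,N'})` (`Transition`), with the equivariance of `β_{N,N'}^bs` for the Galois OUTER actions (representatives compatible up to `Π^tp_X`-conjugation);
* `atLevel N : ThetaFrobenioid C D` — so Prop. 5.2, 5.5, Thm. 5.6, 5.7 (`RootTransport`), Lem. 5.8–5.9,
  Thm. 5.10, Cor. 5.12 as landed apply to each level verbatim;
* `rootMorphismData` — a transition with `N ≠ N'` IS the Corollary 5.12 datum `RootMorphismData (atLevel N) V`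
  (consistency with the landed Cor. 5.12 typing, by construction);
* `ThetaRootPreservedAll Ψ` — Theorem 5.7 (root level) at all levels simultaneously.
NOT typed here (honest): a projective-system LAW `α_{N,N''} = α_{N',N''} ∘ α_{N,N'}` — print asserts the EXISTENCE
of a transition for each `N ∣ N'` (roots being unique only up to the isomorphisms and `μ_N`-twists of
Prop. 4.2 (iv)), not a strict functor; and the residual rigidity clause of Thm. 5.7 is NOT named as a fact
(D-0067 (1)) — it stays abc-iut-L2-d4's binder until the Kummer-injectivity route (Prop. 3.2 (iii)) discharges it.
HONEST FRAMING: DATA and definitions only; nothing asserts that such a tower exists for an actual curve (that is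
the content of §1–§4); typed ≠ proved; no side is taken on any disputed claim downstream.
-/

namespace Literature.AnabelianGeometry.EtaleTheta

open CategoryTheory

universe w v v' u u'

open FrobenioidTheta

/-- **The [EtTh] §5 data at all levels** ("by allowing `N` to vary", Rmk. 4.3.2 p.319 (PDF p.93)): the
level-free part of `ThetaFrobenioid` (pp.322–323 (PDF pp.96–97)) together with, for every "`N ≥ 1` an integer"
(p.323 (PDF p.97)), the level-`N` objects and arrows `A_N, B_N, s^⊓_N, s^⊔_N` (p.330 (PDF p.104)), the Galois
action `ρ_N : Π^tp_X ↠ Aut_D(B_N^bs)` and sections `s^trv_N, s^⊓-gp_N, s^⊔-gp_N` (p.331 (PDF p.105)), the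
constants `K^× ↪ O^×(B_N^birat)` (Lemma 5.8), and for `N ∣ N'` the transition of Remark 4.3.2 (below).  DATA
ONLY.  [cite: MochizukiEtTh2009, §5 p.322–331 (PDF pp.96–105); Rmk 4.3.2 p.318–319 (PDF pp.92–93)] -/
structure ThetaFrobenioidTower (C : Type u) [Category.{v} C] (D : Type u') [Category.{v'} D]
    extends TemperedFrobenioidStub.{w} C D, ThetaSubquotientStub.{w} D where
  /-- "for some odd integer `l ≥ 1`" (p.322 (PDF p.96)). -/
  l : ℕ
  /-- `l` is odd (p.322 (PDF p.96)). -/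
  odd_l : Odd l
  /-- `A_⊚`, "the object defined by the trivial line bundle over `Ÿ̲^log`" (p.322 (PDF p.96)). -/
  Acirc : C
  /-- `Π^tp_X̲` (p.330 (PDF p.104)). -/
  PiX : Type v
  [instGroupPiX : Group PiX]
  [instTopPiX : TopologicalSpace PiX]
  [instTopGroupPiX : IsTopologicalGroup PiX]
  /-- `Π^tp_X̲ ↠ Π^tp_X̲/Π^tp_Y̲ ≅ l·ℤ` (Lemma 5.9 (iii), p.332 (PDF p.106)). -/
  zquot : PiX →* Multiplicative ℤ
  /-- surjectivity of `Π^tp_X̲ ↠ l·ℤ` (p.332 (PDF p.106)). -/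
  zquot_surjective : Function.Surjective zquot
  /-- `Π^tp_Ÿ̲ ⊆ Π^tp_X̲` (p.332 (PDF p.106)). -/
  PiYdd : Subgroup PiX
  /-- `Π^tp_Ÿ̲ ⊆ Π^tp_Y̲` (p.332 (PDF p.106)). -/
  PiYdd_le : PiYdd ≤ zquot.ker
  /-- `[Π^tp_Y̲ : Π^tp_Ÿ̲] = 2` (p.335 (PDF p.109)). -/
  relindex_PiYdd : PiYdd.relIndex zquot.ker = 2
  /-- `Π^tp_Ÿ̲` is normal in `Π^tp_X̲` (p.322 (PDF p.96)). -/
  PiYdd_normal : PiYdd.Normal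
  /-- `Π^tp_Ÿ̲` is open (p.312 (PDF p.86)). -/
  isOpen_PiYdd : IsOpen (PiYdd : Set PiX)
  /-- "`K` a finite extension of `ℚ_p`", `K = K̈` (p.322 (PDF p.96)). -/
  K : Type w
  [instFieldK : Field K]
  /-- `Θ̈ ∈ O^×(A_⊚^birat)` (p.324 (PDF p.98)). -/
  thetaFn : biratUnits Acirc
  /-- `A_N`, the `N`-domain, for every `N ≥ 1` (p.330 (PDF p.104)). -/
  AN : ℕ+ → C
  /-- `B_N`, the `N`-codomain, for every `N ≥ 1` (p.330 (PDF p.104)). -/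
  BN : ℕ+ → C
  /-- `s^⊓_N : A_N → B_N` (p.330 (PDF p.104)). -/
  sCap : ∀ N, AN N ⟶ BN N
  /-- `s^⊔_N : A_N → B_N` (p.330 (PDF p.104)). -/
  sCup : ∀ N, AN N ⟶ BN N
  /-- `s^⊓_N, s^⊔_N` are base-equivalent (p.330 (PDF p.104)). -/
  base_map_sCap : ∀ N, pre.base.map (sCap N) = pre.base.map (sCup N)
  /-- `s^⊓_N` is a pre-step (Prop. 4.2 (iii), p.314 (PDF p.88)). -/
  isPreStep_sCap : ∀ N, pre.IsPreStep (sCap N)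
  /-- `s^⊔_N` is a pre-step (Prop. 4.2 (iii), p.314 (PDF p.88)). -/
  isPreStep_sCup : ∀ N, pre.IsPreStep (sCup N)
  /-- `ρ_N : Π^tp_X ↠ Aut_D(B_N^bs)`, a representative of the natural surjective outer homomorphism (p.331
  (PDF p.105); Def. 4.1 (ii)). -/
  ρ : ∀ N, PiX →* Aut (pre.base.obj (BN N))
  /-- surjectivity of `ρ_N` (Def. 4.1 (ii), p.313 (PDF p.87)). -/
  ρ_surjective : ∀ N, Function.Surjective (ρ N)
  /-- `Ker(ρ_N)` is open (p.312 (PDF p.86)). -/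
  isOpen_ker_ρ : ∀ N, IsOpen ((ρ N).ker : Set PiX)
  /-- `s^trv_N : Aut_D(A_N^bs) → Aut_C(A_N)` (pp.330–331 (PDF pp.104–105)). -/
  strv : ∀ N, Aut (pre.base.obj (AN N)) →* Aut (AN N)
  /-- `s^⊓-gp_N : Aut_D(B_N^bs) → Aut_C(B_N)` (p.331 (PDF p.105)). -/
  sgpCap : ∀ N, Aut (pre.base.obj (BN N)) →* Aut (BN N)
  /-- `s^⊔-gp_N : H_{B_N} → Aut_C(B_N)` on `H_{B_N} = ρ_N(Π^tp_Ÿ̲)` (p.331 (PDF p.105)). -/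
  sgpCup : ∀ N, PiYdd.map (ρ N) →* Aut (BN N)
  /-- the constants `K^× ↪ O^×(B_N^birat)` at every level (Lemma 5.8, p.331 (PDF p.105)). -/
  constEmb : ∀ N, Kˣ →* biratUnits (BN N)
  /-- injectivity of `K^× ↪ O^×(B_N^birat)` (p.331 (PDF p.105)). -/
  constEmb_injective : ∀ N, Function.Injective (constEmb N)
  /-- `α_{N,N'} : A_{N'} → A_N` for `N ∣ N'` (Rmk. 4.3.2, p.318 (PDF p.92)). -/
  α : ∀ {N N' : ℕ+}, (N : ℕ) ∣ N' → (AN N' ⟶ AN N)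
  /-- `β_{N,N'} : B_{N'} → B_N` for `N ∣ N'` (Rmk. 4.3.2, p.318 (PDF p.92)). -/
  β : ∀ {N N' : ℕ+}, (N : ℕ) ∣ N' → (BN N' ⟶ BN N)
  /-- the first commutative square `s^⊓_{N'} ; β_{N,N'} = α_{N,N'} ; s^⊓_N` (Rmk. 4.3.2, p.318 (PDF p.92)). -/
  comm_sCap : ∀ {N N' : ℕ+} (h : (N : ℕ) ∣ N'), sCap N' ≫ β h = α h ≫ sCap N
  /-- the second commutative square `s^⊔_{N'} ; β_{N,N'} = α_{N,N'} ; s^⊔_N` (Rmk. 4.3.2, p.318 (PDF p.92)). -/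
  comm_sCup : ∀ {N N' : ℕ+} (h : (N : ℕ) ∣ N'), sCup N' ≫ β h = α h ≫ sCup N
  /-- "`α_{N,N'}` … is an isometry" (Rmk. 4.3.2, p.319 (PDF p.93)). -/
  isIsometry_α : ∀ {N N' : ℕ+} (h : (N : ℕ) ∣ N'), pre.IsIsometry (α h)
  /-- "… of Frobenius degree `N'/N`" (Rmk. 4.3.2, p.319 (PDF p.93)). -/
  degFr_α : ∀ {N N' : ℕ+} (h : (N : ℕ) ∣ N'), (pre.degFr (α h) : ℕ) * N = N'
  /-- "`β_{N,N'}` is an isometry" (Rmk. 4.3.2, p.319 (PDF p.93)). -/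
  isIsometry_β : ∀ {N N' : ℕ+} (h : (N : ℕ) ∣ N'), pre.IsIsometry (β h)
  /-- "… of Frobenius degree `N'/N`" (Rmk. 4.3.2, p.319 (PDF p.93)). -/
  degFr_β : ∀ {N N' : ℕ+} (h : (N : ℕ) ∣ N'), (pre.degFr (β h) : ℕ) * N = N'
  /-- "`α_{N,N'}` is of base-Frobenius type" (Rmk. 4.3.2, p.319 (PDF p.93); Def. 4.1 (iv)). -/
  baseFrob_α : ∀ {N N' : ℕ+} (h : (N : ℕ) ∣ N'), IsBaseFrobeniusType (α h)
  /-- `β_{N,N'}^bs : B_{N'}^bs → B_N^bs` is `Π^tp_X`-equivariant for the OUTER homomorphisms `Π^tp_X ↠ Aut_D(B^bs)`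
  of Def. 4.1 (ii) (p.313 (PDF p.87): "natural surjective outer homomorphism", natural along morphisms of Galois
  objects): the representatives `ρ_{N'}`, `ρ_N` intertwine along `β_{N,N'}^bs` after conjugating by some element of
  `Π^tp_X` (only the outer classes are canonical, so no stricter compatibility of representatives is imposed). -/
  ρ_comm_β : ∀ {N N' : ℕ+} (h : (N : ℕ) ∣ N'), ∃ x : PiX, ∀ g : PiX,
    (ρ N' g).hom ≫ pre.base.map (β h) = pre.base.map (β h) ≫ (ρ N (x * g * x⁻¹)).hom

attribute [instance] ThetaFrobenioidTower.instGroupPiX ThetaFrobenioidTower.instTopPiX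
  ThetaFrobenioidTower.instTopGroupPiX ThetaFrobenioidTower.instFieldK

namespace ThetaFrobenioidTower

variable {C : Type u} [Category.{v} C] {D : Type u'} [Category.{v'} D] (𝔗 : ThetaFrobenioidTower.{w} C D)

/-- **The level-`N` §5 data of the tower** — literally abc-iut-L2-t4's `ThetaFrobenioid C D` with "`N ≥ 1` an
integer" (p.323 (PDF p.97)) set to `N`; every landed §5 statement (Prop. 5.2, 5.5, Thm. 5.6, 5.7, Lem. 5.8–5.9,
Thm. 5.10, Cor. 5.12) applies to `𝔗.atLevel N` verbatim.  [cite: MochizukiEtTh2009, §5 p.323 (PDF p.97)] -/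
def atLevel (N : ℕ+) : ThetaFrobenioid.{w} C D where
  toTemperedFrobenioidStub := 𝔗.toTemperedFrobenioidStub
  toThetaSubquotientStub := 𝔗.toThetaSubquotientStub
  l := 𝔗.l
  odd_l := 𝔗.odd_l
  N := N
  Acirc := 𝔗.Acirc
  AN := 𝔗.AN N
  BN := 𝔗.BN N
  sCap := 𝔗.sCap N
  sCup := 𝔗.sCup N
  base_map_sCap := 𝔗.base_map_sCap N
  isPreStep_sCap := 𝔗.isPreStep_sCap N
  isPreStep_sCup := 𝔗.isPreStep_sCup N
  PiX := 𝔗.PiX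
  zquot := 𝔗.zquot
  zquot_surjective := 𝔗.zquot_surjective
  PiYdd := 𝔗.PiYdd
  PiYdd_le := 𝔗.PiYdd_le
  relindex_PiYdd := 𝔗.relindex_PiYdd
  PiYdd_normal := 𝔗.PiYdd_normal
  isOpen_PiYdd := 𝔗.isOpen_PiYdd
  ρ := 𝔗.ρ N
  ρ_surjective := 𝔗.ρ_surjective N
  isOpen_ker_ρ := 𝔗.isOpen_ker_ρ N
  strv := 𝔗.strv N
  sgpCap := 𝔗.sgpCap N
  sgpCup := 𝔗.sgpCup N
  K := 𝔗.K
  constEmb := 𝔗.constEmb N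
  constEmb_injective := 𝔗.constEmb_injective N
  thetaFn := 𝔗.thetaFn

/-- The level-`N` data have level `N`. [cite: MochizukiEtTh2009, §5 p.323 (PDF p.97)] -/
@[simp] theorem atLevel_N (N : ℕ+) : (𝔗.atLevel N).N = N := rfl

/-- `A_N` of the level-`N` data. [cite: MochizukiEtTh2009, §5 p.330 (PDF p.104)] -/
@[simp] theorem atLevel_AN (N : ℕ+) : (𝔗.atLevel N).AN = 𝔗.AN N := rfl

/-- `B_N` of the level-`N` data. [cite: MochizukiEtTh2009, §5 p.330 (PDF p.104)] -/
@[simp] theorem atLevel_BN (N : ℕ+) : (𝔗.atLevel N).BN = 𝔗.BN N := rfl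

/-- `s^⊓_N` of the level-`N` data. [cite: MochizukiEtTh2009, §5 p.330 (PDF p.104)] -/
@[simp] theorem atLevel_sCap (N : ℕ+) : (𝔗.atLevel N).sCap = 𝔗.sCap N := rfl

/-- `s^⊔_N` of the level-`N` data. [cite: MochizukiEtTh2009, §5 p.330 (PDF p.104)] -/
@[simp] theorem atLevel_sCup (N : ℕ+) : (𝔗.atLevel N).sCup = 𝔗.sCup N := rfl

/-- `Θ̈` is level-free. [cite: MochizukiEtTh2009, §5 p.324 (PDF p.98)] -/
@[simp] theorem atLevel_thetaFn (N : ℕ+) : (𝔗.atLevel N).thetaFn = 𝔗.thetaFn := rfl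

/-- `l` is level-free. [cite: MochizukiEtTh2009, §5 p.322 (PDF p.96)] -/
@[simp] theorem atLevel_l (N : ℕ+) : (𝔗.atLevel N).l = 𝔗.l := rfl

/-- The Frobenioid-level operations are level-free (so level-free hypotheses about `C`, `Ψ`, pre-steps, divisors —
e.g. those of `Discharge/Sec5Thm57.thetaRootPreserved_of` — are stated ONCE over `𝔗.pre`).
[cite: MochizukiEtTh2009, §5 p.322 (PDF p.96)] -/
@[simp] theorem atLevel_pre (N : ℕ+) : (𝔗.atLevel N).pre = 𝔗.pre := rfl

/-- `Π^tp_X̲` is level-free. [cite: MochizukiEtTh2009, §5 p.330 (PDF p.104)] -/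
@[simp] theorem atLevel_PiX (N : ℕ+) : (𝔗.atLevel N).PiX = 𝔗.PiX := rfl

/-- `ρ_N` of the level-`N` data. [cite: MochizukiEtTh2009, §5 p.331 (PDF p.105)] -/
@[simp] theorem atLevel_ρ (N : ℕ+) : (𝔗.atLevel N).ρ = 𝔗.ρ N := rfl

/-- `s^trv_N` of the level-`N` data. [cite: MochizukiEtTh2009, §5 p.331 (PDF p.105)] -/
@[simp] theorem atLevel_strv (N : ℕ+) : (𝔗.atLevel N).strv = 𝔗.strv N := rfl

/-- `s^⊓-gp_N` of the level-`N` data. [cite: MochizukiEtTh2009, §5 p.331 (PDF p.105)] -/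
@[simp] theorem atLevel_sgpCap (N : ℕ+) : (𝔗.atLevel N).sgpCap = 𝔗.sgpCap N := rfl

/-- `s^⊔-gp_N` of the level-`N` data. [cite: MochizukiEtTh2009, §5 p.331 (PDF p.105)] -/
@[simp] theorem atLevel_sgpCup (N : ℕ+) : (𝔗.atLevel N).sgpCup = 𝔗.sgpCup N := rfl

/-- the level-`N` constants. [cite: MochizukiEtTh2009, Lem 5.8 p.331 (PDF p.105)] -/
@[simp] theorem atLevel_constEmb (N : ℕ+) : (𝔗.atLevel N).constEmb = 𝔗.constEmb N := rfl

/-- **A transition with `N ≠ N'` IS the Corollary 5.12 datum** (p.339 (PDF p.113): "`N` divides `N'`, but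
`M := N'/N ≠ 1`; `s^⊓_{N'}, s^⊔_{N'} : A_{N'} → B_{N'}` an `N'`-th root … [with] commutative diagrams … `α_{N,N'}`
… of base-Frobenius type"): abc-iut-L2-t4's landed `ConstantMultiple.RootMorphismData (𝔗.atLevel N) V`, for any
Prop. 5.2 (i) vocabulary `V` in which `(s^⊓_{N'}, s^⊔_{N'})` is an `N'`-th root of a right fraction-pair of an
`l`-th root of `Θ̈` (`hroot`), with the level-`N'` constants.  [cite: MochizukiEtTh2009, Cor 5.12 p.339 (PDF p.113)] -/
def rootMorphismData {N N' : ℕ+} (h : (N : ℕ) ∣ N') (hne : N ≠ N')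
    (V : FrobenioidThetaBiKummer.BiKummerVocabStub (𝔗.atLevel N))
    (hroot : ∃ (A' : C) (g : 𝔗.biratUnits A'), V.IsRootOf 𝔗.l g 𝔗.thetaFn ∧
      V.IsRootOfRightFractionPair N' g (𝔗.sCap N') (𝔗.sCup N')) :
    ConstantMultiple.RootMorphismData (𝔗.atLevel N) V where
  N' := N'
  dvd := h
  ne := hne
  AN' := 𝔗.AN N'
  BN' := 𝔗.BN N'
  sCap' := 𝔗.sCap N'
  sCup' := 𝔗.sCup N'
  isRoot := hroot
  α := 𝔗.α h
  β := 𝔗.β h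
  comm_sCap := 𝔗.comm_sCap h
  comm_sCup := 𝔗.comm_sCup h
  isIsometry_α := 𝔗.isIsometry_α h
  degFr_α := 𝔗.degFr_α h
  isIsometry_β := 𝔗.isIsometry_β h
  degFr_β := 𝔗.degFr_β h
  baseFrob_α := 𝔗.baseFrob_α h
  constEmb' := 𝔗.constEmb N'

/-- **[EtTh] Theorem 5.7 (root level) at ALL levels**: for the self-equivalence `Ψ`, the root `(s^⊓_N, s^⊔_N)` is
transported to itself up to the printed indeterminacies (abc-iut-L2-t4's `ThetaRootPreserved`, i.e. `RootTransport`
for all `α, β`) for EVERY `N ≥ 1` — the form in which "compatible systems as in Remark 4.3.2" (proof of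
Thm. 5.10 (ii), p.334 (PDF p.108); Rmk. 4.3.2 p.319 (PDF p.93)) enter.
[cite: MochizukiEtTh2009, Thm 5.7 p.329–330 (PDF pp.103–104); Rmk 4.3.2 p.319 (PDF p.93)] -/
def ThetaRootPreservedAll (Ψ : C ≌ C) : Prop := ∀ N : ℕ+, (𝔗.atLevel N).ThetaRootPreserved Ψ

/-- `ThetaRootPreservedAll` level-wise. [cite: MochizukiEtTh2009, Thm 5.7 p.329–330 (PDF pp.103–104)] -/
theorem thetaRootPreservedAll_iff (Ψ : C ≌ C) :
    𝔗.ThetaRootPreservedAll Ψ ↔ ∀ (N : ℕ+) (α : Ψ.functor.obj (𝔗.AN N) ≅ 𝔗.AN N)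
      (β : Ψ.functor.obj (𝔗.BN N) ≅ 𝔗.BN N), (𝔗.atLevel N).RootTransport Ψ α β :=
  Iff.rfl

/-- The Galois actions of two levels `N ∣ N'` have nested kernels: `Ker ρ_{N'} ≤ Ker ρ_N` whenever `β_{N,N'}^bs` is
an epimorphism of `D` (e.g. in a connected temperoid, [SemiAnbd]) — from the equivariance `ρ_comm_β`.
[cite: MochizukiEtTh2009, Def 4.1 (ii) p.313 (PDF p.87); Rmk 4.3.2 p.318 (PDF p.92)] -/
theorem ker_ρ_le {N N' : ℕ+} (h : (N : ℕ) ∣ N') [Epi (𝔗.pre.base.map (𝔗.β h))] :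
    (𝔗.ρ N').ker ≤ (𝔗.ρ N).ker := by
  intro g hg
  rw [MonoidHom.mem_ker] at hg ⊢
  obtain ⟨x, hx⟩ := 𝔗.ρ_comm_β h
  have hc := hx g
  rw [hg] at hc
  have h1 : (1 : Aut (𝔗.pre.base.obj (𝔗.BN N'))).hom = 𝟙 _ := rfl
  have h2 : (1 : Aut (𝔗.pre.base.obj (𝔗.BN N))).hom = 𝟙 _ := rfl
  rw [h1, Category.id_comp] at hc
  -- `ρ_N (x g x⁻¹) = 1`, hence `ρ_N g = 1` (kernels are normal)
  have hconj : 𝔗.ρ N (x * g * x⁻¹) = 1 := by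
    apply Aut.ext
    apply (cancel_epi (𝔗.pre.base.map (𝔗.β h))).mp
    rw [h2, Category.comp_id]
    exact hc.symm
  have := (𝔗.ρ N).normal_ker.conj_mem _ ((MonoidHom.mem_ker).mpr hconj) x⁻¹
  simpa [mul_assoc] using (MonoidHom.mem_ker).mp this

end ThetaFrobenioidTower

end Literature.AnabelianGeometry.EtaleTheta
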